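import Literature.Analysis.FluidPDE.OnsagerBDSVStages
import Literature.Analysis.FunctionSpaces.HolderNorm
import HarnessLib

/-!
# The BDSV scheme: the three stages of the proof of the main proposition (named facts)

Buckmaster–De Lellis–Székelyhidi–Vicol (BDSV), *Onsager's conjecture for admissible weak
solutions*, CPAM 72 (2019) = arXiv:1701.08678, prove their main iterative proposition (Prop. 2.1,
`BDSV.mainIteration`) in three stages (§2.3): *mollification* (§2.4, Prop. 2.2), *gluing*
(§2.5, carried out in §§3–4: Props. 4.2, 4.3, 4.4 and the support property (2.17)) and
*perturbation* (§2.6, carried out in §§5–6: Cor. 5.8, Prop. 6.1, Prop. 6.2). The tree already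
has the last half page of the argument: `BDSV.stagesEstimate → BDSV.mainIteration`
(`OnsagerBDSVStagesProofs.lean`), where `BDSV.stagesEstimate` (`OnsagerBDSVStages.lean`) collects
the seven estimates of the stages consumed there. This file transcribes the three stages
themselves, each as a **named fact** with the quantifier structure of the source (universal
constant `M`; `β, b` as in Prop. 2.1; `α` below a threshold `α₀(β, b)` — the stages use the
parameter inequalities (2.8), (2.11), (4.6), (6.6), all valid for `α` small and `a` large; the
implicit constants of `≲`, which "depend only on `M, α, N`" and on the constants of the previous
stage, made explicit and quantified before the threshold `a₀`):

* `BDSV.mollificationStage` = Prop. 2.2 with (2.10): from an Euler–Reynolds triple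
  `(v_q, p_q, R̊_q)` on `[0,T] × T³` with (2.3)–(2.4), the mollified triple `(v_ℓ, p_ℓ, R̊_ℓ)`
  solves Euler–Reynolds (2.10) and satisfies (2.12)–(2.15) for every `N`;
* `BDSV.gluingStage` = §2.5 (Props. 4.2–4.4 and (2.17)): from `(v_ℓ, p_ℓ, R̊_ℓ)` with (2.13),
  (2.14), a triple `(v̄_q, p̄_q, R̊̄_q)` solving Euler–Reynolds with `supp R̊̄_q ⊂ ⋃ₙ Iₙ × T³`,
  `Iₙ = [tₙ + τ_q/3, tₙ + 2τ_q/3] ∩ [0,T]`, `tₙ = n τ_q` (2.17), and (2.18)–(2.22) for `N ≤ N̄`;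
* `BDSV.perturbationStage` = §2.6 (Cor. 5.8, Props. 6.1, 6.2, with the Euler–Reynolds system of
  §5.4): from `(v̄_q, p̄_q, R̊̄_q)` with (2.17), (2.19)–(2.21) for `N ≤ N̄(β, b, α)`, `‖v̄_q‖₀ ≲ 1`
  and the energy gap (5.2), a triple `(v_{q+1}, p_{q+1}, R̊_{q+1})` with (2.23), (2.24) = (6.1)
  and (2.24c) = Prop. 6.2.

The glue "three stages ⇒ `BDSV.stagesEstimate`" ((5.2) from (2.6), (2.15), (2.22); `‖v̄_q‖₀ ≲ 1`
from (2.5), (2.12), (2.18)) is the subject of a separate proofs file.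

## Vocabulary

* `BDSV.HolderSupLE T f N r B`: BDSV's `‖f‖_{N+r} ≤ B` (App. A: spatial Hölder norms,
  `‖f‖_{m+α} = ∑_{j≤m} [f]_j + [f]_{m+α}`, sup over the time slab), rendered with the accepted
  `Torus.eContDiffHolderNorm N r` (`∑_{j≤N} ‖Dʲ(lift f)‖_∞ + [D^N(lift f)]_r`) of every slice
  `f(t)`, `t ∈ [0,T]`. Integer norms `‖f‖_N` are the case `r = 0` (Mathlib's `0`-Hölder
  seminorm is the oscillation, so `C^{N,0} ≃ C^N` up to a factor `3`); maxima of partial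
  derivatives versus operator norms of Fréchet derivatives cost dimensional constants only. All
  such constants are absorbed by the implicit constants of `≲`.
* `BDSV.advectiveDeriv T u S = ∂ₜ S + (u·∇) S` (the transport derivative `D_t` of (3.9), §4.4,
  one-sided in time within `[0,T]` as in `Torus.IsEulerReynoldsOn`).
* `BDSV.SupportedOnGlueIntervals T τ S`: `S(t) = 0` for every `t ∈ [0,T]` outside
  `⋃ₙ [nτ + τ/3, nτ + 2τ/3]` — for continuous `S` this is (2.17), `supp S ⊂ ⋃ₙ Iₙ × T³`.

## Design choices

* Exponents: `α` is real as in `OnsagerBDSV.lean`; the Hölder exponent is `Real.toNNReal α`.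
  Powers `ℓ^{-N}`, `ℓ^{-N±α}` are real powers of `ℓ = BDSV.mollScale` (`> 0`).
* Constants: the mollification stage outputs a whole family `C : ℕ → ℝ` (Prop. 2.2 holds for all
  `N`, constants depending on `N`); the gluing stage is stated for a requested number `N̄` of
  derivatives with one output constant (finitely many `N`), given any family of input constants;
  the perturbation stage chooses `N̄ = N̄(β, b, α)` itself (§6.1.1: "`N` large enough") and takes
  one input constant. Thresholds `a₀` may depend on everything quantified before them, as in the
  source ("`a` sufficiently large" absorbs all constants).
* Only Euler–Reynolds triples (`Torus.IsEulerReynoldsOn (Icc 0 T)`: jointly smooth, symmetric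
  trace-free stress, mean-zero pressure) are passed between stages; the explicit formulas
  (`v_ℓ = v_q * ψ_ℓ`, `v̄_q = ∑ χᵢ vᵢ`, `v_{q+1} = v̄_q + w_o + w_c`) are part of the proofs, not of
  the statements. (In the display defining `R̊_ℓ` in §2.4 the commutator term carries the
  opposite sign of the one forced by (2.10); immaterial here.)
* `‖v̄_q‖₀ ≲ 1` (used in the proof of Prop. 5.9) and the energy gap (5.2) are hypotheses of the
  perturbation stage, derived in the glue exactly as in the source (first lines of §2.6).

## References

* T. Buckmaster, C. De Lellis, L. Székelyhidi Jr., V. Vicol, *Onsager's conjecture for admissible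
  weak solutions*, Comm. Pure Appl. Math. 72 (2019) 229–274 = arXiv:1701.08678: §2.4 Prop. 2.2,
  (2.10)–(2.15); §2.5 (2.16)–(2.22); §2.6 (5.2)=(2.22′), (2.23)–(2.24c); §4.2 (Euler–Reynolds
  system for the glued triple), Props. 4.2, 4.3, 4.4; §5.4 (5.23)–(5.24); Cor. 5.8; Props. 6.1,
  6.2; App. A (Hölder norms).
-/

open MeasureTheory Set
open scoped NNReal ENNReal ContDiff

noncomputable section

namespace Literature.Analysis.FluidPDE

namespace BDSV

/-- The flat three-torus `T³ = (ℝ/ℤ)³`, local notation. -/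
local notation "𝕋³" => UnitAddTorus (Fin 3)

/-- Euclidean `ℝ³`, local notation. -/
local notation "ℝ³" => EuclideanSpace ℝ (Fin 3)

/-! ## Vocabulary: Hölder bounds on the time slab, the transport derivative, time supports -/

section Vocabulary

variable {F : Type*} [NormedAddCommGroup F] [NormedSpace ℝ F]

/-- `‖f‖_{N+r} ≤ B` in BDSV's notation (App. A): for every `t ∈ [0,T]` the spatial
`C^{N,r}(T³)` norm of the slice `f(t)` — the accepted `Torus.eContDiffHolderNorm N r`, i.e.
`∑_{j≤N} ‖Dʲ‖_∞ + [D^N]_r` of the periodic lift — is at most `B`. For `r = 0` this renders the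
integer norms `‖f‖_N` (up to a factor `3`). [cite: BuckmasterEtAl2018, App. A (Hölder spaces)] -/
def HolderSupLE (T : ℝ) (f : ℝ → 𝕋³ → F) (N : ℕ) (r : ℝ≥0) (B : ℝ) : Prop :=
  ∀ t ∈ Icc 0 T, FunctionSpaces.Torus.eContDiffHolderNorm N r (f t) ≤ ENNReal.ofReal B

/-- The transport (advective) derivative `D_t S := ∂ₜ S + (u·∇) S` of a field `S` along a
velocity field `u` on `[0,T] × T³` (BDSV (3.9): `D_{t,ℓ} = ∂ₜ + v_ℓ·∇`; §4.4, §5: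
`D_{t,q} = ∂ₜ + v̄_q·∇`), with the one-sided time derivative within `[0,T]` of
`Torus.IsEulerReynoldsOn` and `(u·∇)S = DS[u]` (`Torus.convect`). [cite: BuckmasterEtAl2018, §3.2 (3.9)] -/
def advectiveDeriv (T : ℝ) (u : ℝ → 𝕋³ → ℝ³) (S : ℝ → 𝕋³ → F) : ℝ → 𝕋³ → F :=
  fun t x => FunctionSpaces.Torus.timeDerivWithin (Icc 0 T) S t x +
    FunctionSpaces.Torus.convect (u t) (S t) x

/-- The support property (2.17) of the glued Reynolds stress: `supp S ⊂ ⋃ₙ Iₙ × T³` with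
`Iₙ = [tₙ + τ/3, tₙ + 2τ/3] ∩ [0,T]`, `tₙ = nτ`, rendered pointwise (equivalent for continuous
`S`, the sets being closed): `S(t) ≡ 0` for every `t ∈ [0,T]` lying in no
`[nτ + τ/3, nτ + 2τ/3]`, `n ∈ ℕ`. [cite: BuckmasterEtAl2018, §2.5 (2.17)] -/
def SupportedOnGlueIntervals (T τ : ℝ) (S : ℝ → 𝕋³ → F) : Prop :=
  ∀ t ∈ Icc 0 T, (∀ n : ℕ, t ∉ Icc (n * τ + τ / 3) (n * τ + 2 * τ / 3)) → ∀ x, S t x = 0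

variable {T : ℝ} {f : ℝ → 𝕋³ → F} {N : ℕ} {r : ℝ≥0} {B B' : ℝ}

/-- Monotonicity of `‖f‖_{N+r} ≤ B` in `B`. [folklore] -/
theorem HolderSupLE.mono (h : HolderSupLE T f N r B) (hB : B ≤ B') : HolderSupLE T f N r B' :=
  fun t ht => (h t ht).trans (ENNReal.ofReal_le_ofReal hB)

omit [NormedSpace ℝ F] in
/-- The zero field is supported on the glue intervals (trivially). [folklore] -/
theorem supportedOnGlueIntervals_zero (T τ : ℝ) :
    SupportedOnGlueIntervals T τ (fun (_ : ℝ) (_ : 𝕋³) => (0 : F)) :=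
  fun _ _ _ _ => rfl

end Vocabulary

/-! ## The three stages -/

section Stages

/-- **BDSV mollification stage** (Buckmaster–De Lellis–Székelyhidi–Vicol 2019, Prop. 2.2 with
(2.10)). For every `M > 0`, `0 < β < 1/3`, `1 < b < (1-β)/(2β)` there is `α₀(β, b) > 0` such
that for `0 < α < α₀` there are constants `C_N = C_N(β, b, α, M)` (`N ∈ ℕ`) and `a₀ > 1` such
that for all `a ≥ a₀`, `T > 0`, `q` and every Euler–Reynolds triple `(v_q, p_q, R̊_q)` on
`[0,T] × T³` with (2.3) `‖R̊_q‖₀ ≤ δ_{q+1} λ_q^{-3α}` and (2.4) `‖v_q‖₁ ≤ M δ_q^{1/2} λ_q`, the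
mollification `v_ℓ = v_q * ψ_ℓ`,
`R̊_ℓ = R̊_q * ψ_ℓ - ((v_q ⊗̊ v_q) * ψ_ℓ - v_ℓ ⊗̊ v_ℓ)` at length `ℓ` (2.10)′ (with the pressure
`p_ℓ`) is an Euler–Reynolds triple on `[0,T] × T³` (2.10) satisfying, for every `N ≥ 0`:
(2.12) `‖v_ℓ - v_q‖₀ ≲ δ_{q+1}^{1/2} λ_q^{-α}`; (2.13) `‖v_ℓ‖_{N+1} ≲ δ_q^{1/2} λ_q ℓ^{-N}`;
(2.14) `‖R̊_ℓ‖_{N+α} ≲ δ_{q+1} ℓ^{-N+α}`; (2.15) `|∫_{T³} |v_q|² - |v_ℓ|² dx| ≲ δ_{q+1} ℓ^α`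
(the constants for order `N` being `C_N`; (2.12), (2.15) with `C_0`). Transcription: triples are
`Torus.IsEulerReynoldsOn (Icc 0 T)`; (2.3), (2.4) as in `BDSV.InductiveEstimates`; `‖·‖_{N+1}`,
`‖·‖_{N+α}` by `BDSV.HolderSupLE`; `ℓ = BDSV.mollScale`. [cite: BuckmasterEtAl2018, Prop. 2.2] -/
def mollificationStage : Prop :=
  ∀ M : ℝ, 0 < M → ∀ β : ℝ, 0 < β → β < 1 / 3 → ∀ b : ℝ, 1 < b → b < (1 - β) / (2 * β) →
    ∃ α₀ : ℝ, 0 < α₀ ∧ ∀ α : ℝ, 0 < α → α < α₀ →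
      ∃ (C : ℕ → ℝ) (a₀ : ℝ), 1 < a₀ ∧ ∀ a : ℝ, a₀ ≤ a → ∀ T : ℝ, 0 < T →
        ∀ (q : ℕ) (v : ℝ → 𝕋³ → ℝ³) (p : ℝ → 𝕋³ → ℝ) (R : ℝ → 𝕋³ → Fin 3 → ℝ³),
          Torus.IsEulerReynoldsOn (Icc 0 T) v p R →
          SupLE T R (amp β a b (q + 1) * freq a b q ^ (-3 * α)) →
          (∃ B₀ B₁ : ℝ, SupLE T v B₀ ∧ DerivSupLE T v B₁ ∧
            B₀ + B₁ ≤ M * Real.sqrt (amp β a b q) * freq a b q) →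
            ∃ (vℓ : ℝ → 𝕋³ → ℝ³) (pℓ : ℝ → 𝕋³ → ℝ) (Rℓ : ℝ → 𝕋³ → Fin 3 → ℝ³),
              Torus.IsEulerReynoldsOn (Icc 0 T) vℓ pℓ Rℓ ∧
              SupLE T (fun t x => vℓ t x - v t x)
                (C 0 * (Real.sqrt (amp β a b (q + 1)) * freq a b q ^ (-α))) ∧
              (∀ N : ℕ, HolderSupLE T vℓ (N + 1) 0
                (C N * (Real.sqrt (amp β a b q) * freq a b q * mollScale β α a b q ^ (-(N : ℝ))))) ∧
              (∀ N : ℕ, HolderSupLE T Rℓ N (Real.toNNReal α)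
                (C N * (amp β a b (q + 1) * mollScale β α a b q ^ (-(N : ℝ) + α)))) ∧
              ∀ t ∈ Icc 0 T, |(∫ x, ‖v t x‖ ^ 2) - ∫ x, ‖vℓ t x‖ ^ 2| ≤
                C 0 * (amp β a b (q + 1) * mollScale β α a b q ^ α)

/-- **BDSV gluing stage** (Buckmaster–De Lellis–Székelyhidi–Vicol 2019, §2.5: "we aim to
construct a new triple `(v̄_q, R̊̄_q, p̄_q)` solving the Euler–Reynolds equation such that the
temporal support of `R̊̄_q` is contained in pairwise disjoint intervals `Iᵢ` …", (2.17), and the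
estimates (2.18)–(2.22) "where the implicit constants depend only on `M, α` and `N`,
cf. Propositions 4.2, 4.3 and 4.4"; the construction is §§3–4). For every `M > 0`,
`0 < β < 1/3`, `1 < b < (1-β)/(2β)` there is `α₀(β, b) > 0` such that for `0 < α < α₀`, every
`N̄ ∈ ℕ` and every family of constants `(C_N)` there are `C` and `a₀ > 1` such that for all
`a ≥ a₀`, `T > 0`, `q` and every Euler–Reynolds triple `(v_ℓ, p_ℓ, R̊_ℓ)` on `[0,T] × T³`
satisfying (2.13) `‖v_ℓ‖_{N+1} ≤ C_N δ_q^{1/2} λ_q ℓ^{-N}` and (2.14)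
`‖R̊_ℓ‖_{N+α} ≤ C_N δ_{q+1} ℓ^{-N+α}` for all `N`, there is an Euler–Reynolds triple
`(v̄_q, p̄_q, R̊̄_q)` on `[0,T] × T³` (§4.2) with (2.17) `supp R̊̄_q ⊂ ⋃ₙ Iₙ × T³`,
`Iₙ = [tₙ + τ_q/3, tₙ + 2τ_q/3] ∩ [0,T]`, `tₙ = n τ_q`, `τ_q = ℓ^{2α} δ_q^{-1/2} λ_q^{-1}` (2.16),
and, for all `N ≤ N̄`: (2.18) `‖v̄_q - v_ℓ‖₀ ≤ C δ_{q+1}^{1/2} ℓ^α`;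
(2.19) `‖v̄_q‖_{1+N} ≤ C δ_q^{1/2} λ_q ℓ^{-N}`; (2.20) `‖R̊̄_q‖_{N+α} ≤ C δ_{q+1} ℓ^{-N+α}`;
(2.21) `‖(∂ₜ + v̄_q·∇) R̊̄_q‖_{N+α} ≤ C δ_{q+1} δ_q^{1/2} λ_q ℓ^{-N-α}`;
(2.22) `|∫_{T³} |v̄_q|² - |v_ℓ|² dx| ≤ C δ_{q+1} ℓ^α`. Transcription as in
`BDSV.mollificationStage`; `τ_q = BDSV.glueScale`, (2.17) by `BDSV.SupportedOnGlueIntervals`,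
`∂ₜ + v̄_q·∇` by `BDSV.advectiveDeriv`. [cite: BuckmasterEtAl2018, §2.5 (2.17)–(2.22)] -/
def gluingStage : Prop :=
  ∀ M : ℝ, 0 < M → ∀ β : ℝ, 0 < β → β < 1 / 3 → ∀ b : ℝ, 1 < b → b < (1 - β) / (2 * β) →
    ∃ α₀ : ℝ, 0 < α₀ ∧ ∀ α : ℝ, 0 < α → α < α₀ → ∀ (Nbar : ℕ) (Cin : ℕ → ℝ),
      ∃ (C a₀ : ℝ), 1 < a₀ ∧ ∀ a : ℝ, a₀ ≤ a → ∀ T : ℝ, 0 < T →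
        ∀ (q : ℕ) (vℓ : ℝ → 𝕋³ → ℝ³) (pℓ : ℝ → 𝕋³ → ℝ) (Rℓ : ℝ → 𝕋³ → Fin 3 → ℝ³),
          Torus.IsEulerReynoldsOn (Icc 0 T) vℓ pℓ Rℓ →
          (∀ N : ℕ, HolderSupLE T vℓ (N + 1) 0
            (Cin N * (Real.sqrt (amp β a b q) * freq a b q * mollScale β α a b q ^ (-(N : ℝ))))) →
          (∀ N : ℕ, HolderSupLE T Rℓ N (Real.toNNReal α)
            (Cin N * (amp β a b (q + 1) * mollScale β α a b q ^ (-(N : ℝ) + α)))) →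
            ∃ (vbar : ℝ → 𝕋³ → ℝ³) (pbar : ℝ → 𝕋³ → ℝ) (Rbar : ℝ → 𝕋³ → Fin 3 → ℝ³),
              Torus.IsEulerReynoldsOn (Icc 0 T) vbar pbar Rbar ∧
              SupportedOnGlueIntervals T (glueScale β α a b q) Rbar ∧
              SupLE T (fun t x => vbar t x - vℓ t x)
                (C * (Real.sqrt (amp β a b (q + 1)) * mollScale β α a b q ^ α)) ∧
              (∀ N : ℕ, N ≤ Nbar → HolderSupLE T vbar (N + 1) 0
                (C * (Real.sqrt (amp β a b q) * freq a b q * mollScale β α a b q ^ (-(N : ℝ))))) ∧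
              (∀ N : ℕ, N ≤ Nbar → HolderSupLE T Rbar N (Real.toNNReal α)
                (C * (amp β a b (q + 1) * mollScale β α a b q ^ (-(N : ℝ) + α)))) ∧
              (∀ N : ℕ, N ≤ Nbar → HolderSupLE T (advectiveDeriv T vbar Rbar) N (Real.toNNReal α)
                (C * (amp β a b (q + 1) * Real.sqrt (amp β a b q) * freq a b q *
                  mollScale β α a b q ^ (-(N : ℝ) - α)))) ∧
              ∀ t ∈ Icc 0 T, |(∫ x, ‖vbar t x‖ ^ 2) - ∫ x, ‖vℓ t x‖ ^ 2| ≤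
                C * (amp β a b (q + 1) * mollScale β α a b q ^ α)

/-- **BDSV perturbation stage** (Buckmaster–De Lellis–Székelyhidi–Vicol 2019, §2.6: "Starting
with the solution `(v̄_q, p̄_q, R̊̄_q)` satisfying (2.17) and the estimates (2.18)–(2.22), we then
produce a new solution `(v_{q+1}, p_{q+1}, R̊_{q+1})` of the Euler–Reynolds system (2.2) with
estimates (2.23)–(2.24c), cf. Corollary 5.8 and Propositions 6.1 and 6.2", given the energy gap
(5.2) `δ_{q+1}/(2λ_q^α) ≤ e(t) - ∫ |v̄_q|² ≤ 2δ_{q+1}`; the construction — Mikado flows along the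
backward flows of `v̄_q`, squiggling cut-offs, the inverse divergence operator — is §§5–6, and
the universal constant is `M = 64 M̄ ∑_{k≠0} |k|^{-4}`, Def. 5.6). There is a universal `M > 0`
such that for `0 < β < 1/3`, `1 < b < (1-β)/(2β)` there is `α₀(β, b) > 0` such that for
`0 < α < α₀` there is a number of derivatives `N̄ = N̄(β, b, α)` (§6.1.1) such that for all
constants `C_in`, `C₀` there are `C` and `a₀ > 1` such that for all `a ≥ a₀`, `T > 0`, every
normalised energy profile `e` on `[0,T]` ((2.1), `BDSV.IsNormalisedProfile`), every `q` and every
Euler–Reynolds triple `(v̄_q, p̄_q, R̊̄_q)` on `[0,T] × T³` with (2.17), `‖v̄_q‖₀ ≤ C₀`, and, for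
`N ≤ N̄`, (2.19) `‖v̄_q‖_{1+N} ≤ C_in δ_q^{1/2} λ_q ℓ^{-N}`, (2.20)
`‖R̊̄_q‖_{N+α} ≤ C_in δ_{q+1} ℓ^{-N+α}`, (2.21)
`‖(∂ₜ + v̄_q·∇) R̊̄_q‖_{N+α} ≤ C_in δ_{q+1} δ_q^{1/2} λ_q ℓ^{-N-α}`, and with the energy gap (5.2)
on `[0,T]`, there is an Euler–Reynolds triple `(v_{q+1}, p_{q+1}, R̊_{q+1})` on `[0,T] × T³`
(§5.4, (5.23)–(5.24)) with (2.23) `‖v_{q+1} - v̄_q‖₀ + λ_{q+1}^{-1} ‖v_{q+1} - v̄_q‖₁ ≤ (M/2) δ_{q+1}^{1/2}`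
(Cor. 5.8), (2.24) in the form (6.1) `‖R̊_{q+1}‖₀ ≤ C δ_{q+1}^{1/2} δ_q^{1/2} λ_q λ_{q+1}^{-1+4α}`
(Prop. 6.1) and (2.24c) `|e(t) - ∫ |v_{q+1}|² - δ_{q+2}/2| ≤ C δ_q^{1/2} δ_{q+1}^{1/2} λ_q^{1+2α} λ_{q+1}^{-1}`
for `t ∈ [0,T]` (Prop. 6.2). Transcription as in `BDSV.gluingStage`; (2.23) is
`BDSV.VelocityIncrementBound` with constant `M/2`. [cite: BuckmasterEtAl2018, §2.6 (2.23)–(2.24c), Cor. 5.8, Props. 6.1–6.2] -/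
def perturbationStage : Prop :=
  ∃ M : ℝ, 0 < M ∧
    ∀ β : ℝ, 0 < β → β < 1 / 3 → ∀ b : ℝ, 1 < b → b < (1 - β) / (2 * β) →
      ∃ α₀ : ℝ, 0 < α₀ ∧ ∀ α : ℝ, 0 < α → α < α₀ → ∃ Nbar : ℕ, ∀ (Cin C₀ : ℝ),
        ∃ (C a₀ : ℝ), 1 < a₀ ∧ ∀ a : ℝ, a₀ ≤ a →
          ∀ T : ℝ, 0 < T → ∀ e : ℝ → ℝ, IsNormalisedProfile T e →
            ∀ (q : ℕ) (vbar : ℝ → 𝕋³ → ℝ³) (pbar : ℝ → 𝕋³ → ℝ) (Rbar : ℝ → 𝕋³ → Fin 3 → ℝ³),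
              Torus.IsEulerReynoldsOn (Icc 0 T) vbar pbar Rbar →
              SupportedOnGlueIntervals T (glueScale β α a b q) Rbar →
              SupLE T vbar C₀ →
              (∀ N : ℕ, N ≤ Nbar → HolderSupLE T vbar (N + 1) 0
                (Cin * (Real.sqrt (amp β a b q) * freq a b q * mollScale β α a b q ^ (-(N : ℝ))))) →
              (∀ N : ℕ, N ≤ Nbar → HolderSupLE T Rbar N (Real.toNNReal α)
                (Cin * (amp β a b (q + 1) * mollScale β α a b q ^ (-(N : ℝ) + α)))) →
              (∀ N : ℕ, N ≤ Nbar → HolderSupLE T (advectiveDeriv T vbar Rbar) N (Real.toNNReal α)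
                (Cin * (amp β a b (q + 1) * Real.sqrt (amp β a b q) * freq a b q *
                  mollScale β α a b q ^ (-(N : ℝ) - α)))) →
              (∀ t ∈ Icc 0 T,
                amp β a b (q + 1) * freq a b q ^ (-α) / 2 ≤ e t - ∫ x, ‖vbar t x‖ ^ 2 ∧
                  e t - ∫ x, ‖vbar t x‖ ^ 2 ≤ 2 * amp β a b (q + 1)) →
                ∃ (v' : ℝ → 𝕋³ → ℝ³) (p' : ℝ → 𝕋³ → ℝ) (R' : ℝ → 𝕋³ → Fin 3 → ℝ³),
                  Torus.IsEulerReynoldsOn (Icc 0 T) v' p' R' ∧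
                  VelocityIncrementBound (M / 2) β a b T q (fun t x => v' t x - vbar t x) ∧
                  SupLE T R' (C * (Real.sqrt (amp β a b (q + 1)) * Real.sqrt (amp β a b q) *
                    freq a b q * freq a b (q + 1) ^ (-1 + 4 * α))) ∧
                  ∀ t ∈ Icc 0 T, |e t - (∫ x, ‖v' t x‖ ^ 2) - amp β a b (q + 2) / 2| ≤
                    C * (Real.sqrt (amp β a b q) * Real.sqrt (amp β a b (q + 1)) *
                      freq a b q ^ (1 + 2 * α) * (freq a b (q + 1))⁻¹)

end Stages

end BDSV

end Literature.Analysis.FluidPDE
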